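import Literature.Dynamics.Hyperbolic.HyperbolicSemiflowModelOrbits

/-!
# Equilibria of a `C²` local semiflow model: the zero set of the flow direction

Topic `Literature/Dynamics/Hyperbolic`.  Fully proved (no definitions, no named facts), continuing `HyperbolicSemiflowModelOrbits.lean`
for `h : IsHyperbolicSemiflowModel U Λ g m`:

* §1 `hasDerivWithinAt_orbit_of_mem` — the orbit of `x ∈ Λ` has RIGHT DERIVATIVE `flowDir g (g t x)` at every `t ≥ 0`;
  `fderiv_map_apply_flowDir` — equivariance `D(g_t)(x) X(x) = X(g_t x)` for `t ∈ (0,2)` (general-time form of `fderiv_apply_flowDir`);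
* §2 `flowDir_apply_eq_zero` — the zero set of `X = flowDir g` on `Λ` is forward invariant; `eq_self_of_flowDir_eq_zero`,
  `flowDir_eq_zero_iff` — `X(x) = 0` IFF `x` is an EQUILIBRIUM (`g t x = x` for all `t ≥ 0`; a continuous orbit with zero right
  derivative is constant); `isCompact_equilibria` — the equilibria of `Λ` form a compact set;
* §3 `closing_of_isEquilibrium` — at an equilibrium the closing clause of `HasAmbientClosing` holds trivially (`z = x`, `T = n`).

Use (closing lemma `stub_ambientClosing`, line `ergodic-budget-selection-closing` of `Summits/AnomalousDissipation`): split each Pesin set into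
its equilibria (closed trivially) and its non-equilibria, where `X ≠ 0` and TRANSVERSAL sections exist (`HyperbolicSemiflowModelGlue`
§1); no mixed case arises because the zero set of `X` is invariant.

## References

* Z. Lian, L.-S. Young, *Lyapunov exponents, periodic orbits, and horseshoes for semiflows on Hilbert spaces*, J. Amer. Math. Soc. 25
  (2012) 637–665, §1. [LianYoung2012]
-/

noncomputable section

open Set Function Metric

namespace Literature.Dynamics.Hyperbolic

namespace IsHyperbolicSemiflowModel

variable {E : Type*} [NormedAddCommGroup E] [NormedSpace ℝ E] [MeasurableSpace E]
  {U Λ : Set E} {g : ℝ → E → E} {m : MeasureTheory.Measure E}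

/-! ## §1 Right derivatives of orbits and equivariance at all times -/

/-- **The orbit of `x ∈ Λ` has right derivative `X(g_t x)` at every `t ≥ 0`** (`g_s x = g_{s−t} (g_t x)` for `s ≥ t`, and the
flow direction is the right derivative at `0`). [folklore] -/
theorem hasDerivWithinAt_orbit_of_mem (h : IsHyperbolicSemiflowModel U Λ g m) {x : E} (hx : x ∈ Λ) {t : ℝ} (ht : 0 ≤ t) :
    HasDerivWithinAt (fun s => g s x) (flowDir g (g t x)) (Ici t) t := by
  have h0 : HasDerivWithinAt (fun u => g u (g t x)) (flowDir g (g t x)) (Ici 0) ((fun s : ℝ => s - t) t) := by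
    simp only [sub_self]; exact h.hasDerivWithinAt_flowDir (h.mapsTo t ht hx)
  have hsub : HasDerivWithinAt (fun s : ℝ => s - t) 1 (Ici t) t := by
    simpa using (hasDerivWithinAt_id t (Ici t)).sub_const t
  have hcomp := HasDerivWithinAt.scomp (h := fun s : ℝ => s - t) t h0 hsub
    (fun s hs => mem_Ici.2 (sub_nonneg.2 (mem_Ici.1 hs)))
  rw [one_smul] at hcomp
  refine hcomp.congr (fun s hs => ?_) ?_
  · show g s x = g (s - t) (g t x)
    rw [← h.map_add_of_mem (sub_nonneg.2 (mem_Ici.1 hs)) ht hx, sub_add_cancel]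
  · show g t x = g (t - t) (g t x)
    rw [sub_self, h.map_zero _ (h.subset (h.mapsTo t ht hx))]

/-- **Equivariance at all interior times**: `D(g_t)(x) X(x) = X(g_t x)` for `x ∈ Λ`, `t ∈ (0,2)`. [folklore] -/
theorem fderiv_map_apply_flowDir (h : IsHyperbolicSemiflowModel U Λ g m) {x : E} (hx : x ∈ Λ) {t : ℝ} (ht : t ∈ Ioo (0 : ℝ) 2) :
    fderiv ℝ (g t) x (flowDir g x) = flowDir g (g t x) := by
  have hgt : HasFDerivAt (g t) (fderiv ℝ (g t) x) x := (h.hasFDerivAt_map (h.subset hx) ht).differentiableAt.hasFDerivAt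
  have hgt' : HasFDerivAt (g t) (fderiv ℝ (g t) x) (g 0 x) := by rwa [h.map_zero x (h.subset hx)]
  have hcomp : HasDerivWithinAt (fun s => g t (g s x)) (fderiv ℝ (g t) x (flowDir g x)) (Ici 0) 0 :=
    hgt'.comp_hasDerivWithinAt 0 (h.hasDerivWithinAt_flowDir hx)
  have heq : ∀ s ∈ Ici (0 : ℝ), g t (g s x) = g s (g t x) := fun s hs => by
    rw [← h.map_add_of_mem ht.1.le (mem_Ici.1 hs) hx, add_comm, h.map_add_of_mem (mem_Ici.1 hs) ht.1.le hx]
  have hcomp' : HasDerivWithinAt (fun s => g s (g t x)) (fderiv ℝ (g t) x (flowDir g x)) (Ici 0) 0 :=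
    hcomp.congr (fun s hs => (heq s hs).symm) (heq 0 self_mem_Ici).symm
  exact (uniqueDiffOn_Ici (0 : ℝ) 0 self_mem_Ici).eq_deriv _ hcomp' (h.hasDerivWithinAt_flowDir (h.mapsTo t ht.1.le hx))

/-! ## §2 The zero set of the flow direction = the equilibria -/

/-- **The zero set of the flow direction on `Λ` is forward invariant**: `X(x) = 0 ⇒ X(g_t x) = 0` for `t ≥ 0` (cut `t` into equal
pieces of length `< 2` and use equivariance). [folklore] -/
theorem flowDir_apply_eq_zero (h : IsHyperbolicSemiflowModel U Λ g m) {x : E} (hx : x ∈ Λ) (hX : flowDir g x = 0) {t : ℝ}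
    (ht : 0 ≤ t) : flowDir g (g t x) = 0 := by
  rcases ht.eq_or_lt with heq | htpos
  · rw [← heq, h.map_zero x (h.subset hx)]; exact hX
  -- `t = (N+1) s` with `s ∈ (0, 2)`
  obtain ⟨N, hN⟩ := exists_nat_gt (t / 2)
  set s : ℝ := t / (N + 1) with hsdef
  have hN1 : (0 : ℝ) < N + 1 := by positivity
  have hs0 : 0 < s := div_pos htpos hN1
  have hs2 : s < 2 := by
    rw [hsdef, div_lt_iff₀ hN1]
    rw [div_lt_iff₀ two_pos] at hN
    nlinarith
  have key : ∀ k : ℕ, flowDir g (g (k * s) x) = 0 := by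
    intro k
    induction k with
    | zero => rw [Nat.cast_zero, zero_mul, h.map_zero x (h.subset hx)]; exact hX
    | succ k ih =>
      have hk0 : 0 ≤ (k : ℝ) * s := mul_nonneg k.cast_nonneg hs0.le
      have e : g (((k + 1 : ℕ) : ℝ) * s) x = g s (g (k * s) x) := by
        rw [Nat.cast_succ, add_mul, one_mul, add_comm, h.map_add_of_mem hs0.le hk0 hx]
      rw [e, ← h.fderiv_map_apply_flowDir (h.mapsTo _ hk0 hx) ⟨hs0, hs2⟩, ih]
      exact (fderiv ℝ (g s) _).map_zero
  have e : t = ((N + 1 : ℕ) : ℝ) * s := by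
    rw [hsdef, Nat.cast_succ, mul_div_cancel₀ _ hN1.ne']
  rw [e]
  exact key (N + 1)

/-- **A point of `Λ` with zero flow direction is an equilibrium**: `X(x) = 0 ⇒ g t x = x` for all `t ≥ 0` (the orbit is continuous
with zero right derivative everywhere, hence constant). [folklore] -/
theorem eq_self_of_flowDir_eq_zero (h : IsHyperbolicSemiflowModel U Λ g m) {x : E} (hx : x ∈ Λ) (hX : flowDir g x = 0) {t : ℝ}
    (ht : 0 ≤ t) : g t x = x := by
  have hderiv : ∀ s ∈ Ico 0 t, HasDerivWithinAt (fun r => g r x) 0 (Ici s) s := fun s hs => by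
    have := h.hasDerivWithinAt_orbit_of_mem hx hs.1
    rwa [h.flowDir_apply_eq_zero hx hX hs.1] at this
  obtain ⟨V, hV0, hV⟩ := h.exists_forall_dist_orbit_le
  have hcont : ContinuousOn (fun r => g r x) (Icc 0 t) := by
    refine Metric.continuousOn_iff.2 fun s hs ε hε => ⟨ε / (V + 1), by positivity, fun r hr hrs => ?_⟩
    rw [Real.dist_eq] at hrs
    have hV1 : 0 < V + 1 := by linarith
    calc dist (g r x) (g s x) ≤ V * |r - s| := hV x hx r s hr.1 hs.1
      _ ≤ (V + 1) * |r - s| := mul_le_mul_of_nonneg_right (by linarith) (abs_nonneg _)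
      _ < (V + 1) * (ε / (V + 1)) := mul_lt_mul_of_pos_left hrs hV1
      _ = ε := mul_div_cancel₀ ε hV1.ne'
  have := constant_of_has_deriv_right_zero hcont hderiv t (right_mem_Icc.2 ht)
  rwa [h.map_zero x (h.subset hx)] at this

/-- **Zero flow direction ⟺ equilibrium** (for `x ∈ Λ`). [folklore] -/
theorem flowDir_eq_zero_iff (h : IsHyperbolicSemiflowModel U Λ g m) {x : E} (hx : x ∈ Λ) :
    flowDir g x = 0 ↔ ∀ t : ℝ, 0 ≤ t → g t x = x := by
  refine ⟨fun hX t ht => h.eq_self_of_flowDir_eq_zero hx hX ht, fun heq => ?_⟩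
  have hd : HasDerivWithinAt (fun t => g t x) 0 (Ici 0) 0 :=
    (hasDerivWithinAt_const (0 : ℝ) (Ici 0) x).congr (fun t ht => heq t (mem_Ici.1 ht)) (heq 0 le_rfl)
  exact (uniqueDiffOn_Ici (0 : ℝ) 0 self_mem_Ici).eq_deriv _ (h.hasDerivWithinAt_flowDir hx) hd

/-- **The equilibria of `Λ` form a compact set** (the zero set of the continuous `flowDir g` on the compact `Λ`). [folklore] -/
theorem isCompact_equilibria (h : IsHyperbolicSemiflowModel U Λ g m) : IsCompact {x ∈ Λ | flowDir g x = 0} := by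
  have hc : IsClosed (Λ ∩ flowDir g ⁻¹' {0}) :=
    h.continuousOn_flowDir.preimage_isClosed_of_isClosed h.isCompact.isClosed isClosed_singleton
  have he : {x ∈ Λ | flowDir g x = 0} = Λ ∩ flowDir g ⁻¹' {0} := by
    ext x; simp
  rw [he]
  exact h.isCompact.of_isClosed_subset hc inter_subset_left

/-! ## §3 Closing at an equilibrium is trivial -/

/-- At an equilibrium `x ∈ Λ` the closing clause of `HasAmbientClosing` holds with `z = x`, `T = n`, accuracy `0 ≤ η`. [folklore] -/
theorem closing_of_isEquilibrium (h : IsHyperbolicSemiflowModel U Λ g m) {x : E} (hx : x ∈ Λ) (heq : ∀ t : ℝ, 0 ≤ t → g t x = x)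
    {n : ℕ} (hn : 0 < n) {η : ℝ} (hη : 0 ≤ η) :
    ∃ z ∈ U, ∃ T : ℝ, 0 < T ∧ |T - n| ≤ η ∧ (∀ t ∈ Icc 0 T, g t z ∈ U) ∧ g T z = z ∧
      ∀ k : ℕ, k ≤ n → dist (g k z) (g k x) ≤ η := by
  refine ⟨x, h.subset hx, n, by exact_mod_cast hn, by simpa using hη, fun t ht => ?_, heq n n.cast_nonneg, fun k _ => by simpa using hη⟩
  rw [heq t ht.1]
  exact h.subset hx

end IsHyperbolicSemiflowModel

end Literature.Dynamics.Hyperbolic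

end
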